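import Summits.HubbardSuperconductivity.HubbardSuperconductivity.Theses.SpinStructureRigidity
import Literature.MathematicalPhysics.QuantumLattice.TwistedHoppingPlaneWaves
import Literature.MathematicalPhysics.QuantumLattice.FermiCurveGridCount
import HarnessLib

/-!
# `SsrFreeParityCollapse` (route `SpinStructureRigidity`, stmt-HubbardSuperconductivity-1491)

The free-fermion temporal collapse: for the free electron gas on the `L × L` torus with a boost-gauge
twist `θ` and chemical potential `μ ∈ (-4,4)`, at inverse temperature `β = κL`,
`|tr((-1)^N e^{-β dΓ h(θ,μ)})| ≤ e^{-cL} tr e^{-β dΓ h(θ,μ)}` uniformly in `θ`.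

Proof: by the plane-wave diagonalisation (`Literature/…/TwistedHoppingPlaneWaves`) the two traces
are `∏_k (1 ∓ e^{-βξ_k})²`; modewise `(1 - t)² ≤ (1 + t)²`, and for the `≥ c'L` momenta within
`2π/L` of the Fermi curve (`Literature/…/FermiCurveGridCount`) `|βξ_k| ≤ 2πκ`, where
`(1 - t)² ≤ tanh²(πκ) (1 + t)²`; hence the ratio is at most `tanh(πκ)^{2c'L} = e^{-cL}`.
-/

set_option linter.dupNamespace false

namespace Summit.HubbardSuperconductivity.HubbardSuperconductivity.Theorems.SpinStructureRigidity

open Literature.MathematicalPhysics.QuantumLattice Literature.Probability.LatticeModels Matrix Finset Real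

/-- One mode: for `r ≤ t`, `t r ≤ 1`, `(1 - t)²(1 + r)² ≤ (1 - r)²(1 + t)²`
(`(1-r)²(1+t)² - (1-t)²(1+r)² = 4(t - r)(1 - rt)`), i.e. `tanh²` is maximal at the ends of
`[-a, a]`. [folklore] -/
theorem one_sub_sq_mul_le {r t : ℝ} (hrt : r ≤ t) (htr : t * r ≤ 1) :
    (1 - t) ^ 2 * (1 + r) ^ 2 ≤ (1 - r) ^ 2 * (1 + t) ^ 2 := by
  nlinarith [mul_nonneg (sub_nonneg.mpr hrt) (sub_nonneg.mpr htr)]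

/-- **`SsrFreeParityCollapse` holds** (stmt-HubbardSuperconductivity-1491): the parity-twisted trace
of the free twisted gas is exponentially small in `L` against its partition function at `β = κL`,
uniformly in the twist, for `μ` inside the band. [cite: ScalapinoWhiteZhang1993, §II] -/
theorem ssrFreeParityCollapse_proof : Theses.SpinStructureRigidity.SsrFreeParityCollapse := by
  intro μ hμ κ hκ
  obtain ⟨c', hc', L₁, hcount⟩ := exists_card_abs_band_le hμ
  set r : ℝ := Real.exp (-(2 * π * κ)) with hr
  have hr0 : 0 < r := Real.exp_pos _
  have hr1 : r < 1 := Real.exp_lt_one_iff.2 (by nlinarith [Real.pi_pos])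
  set q : ℝ := ((1 - r) / (1 + r)) ^ 2 with hq
  have hq0 : 0 < q := by
    rw [hq]
    exact pow_pos (div_pos (by linarith) (by linarith)) 2
  have hq1 : q < 1 := by
    rw [hq]
    have h1 : (1 - r) / (1 + r) < 1 := by rw [div_lt_one (by linarith)]; linarith
    have h0 : 0 < (1 - r) / (1 + r) := div_pos (by linarith) (by linarith)
    nlinarith
  have hlogq : Real.log q < 0 := Real.log_neg hq0 hq1
  refine ⟨c' * -Real.log q, mul_pos hc' (neg_pos.mpr hlogq), L₁, ?_⟩
  intro L _ hL H Z ZP θ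
  show |((parityOp : Matrix (Finset (Orb (FermionTorus 2 L))) (Finset (Orb (FermionTorus 2 L))) ℂ) *
      gibbsWeight (κ * L) (dGamma (twistedOneBody L θ μ))).trace.re| ≤
    Real.exp (-(c' * -Real.log q * L)) * (partitionFn (κ * L) (dGamma (twistedOneBody L θ μ))).re
  rw [trace_parityOp_mul_gibbsWeight_dGamma_twistedOneBody, partitionFn_dGamma_twistedOneBody,
    Complex.ofReal_re, Complex.ofReal_re]
  have hLpos : (0 : ℝ) < L := Nat.cast_pos.mpr (Nat.pos_of_ne_zero (NeZero.ne L))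
  -- the near-Fermi-curve momenta
  set S : Finset (TorusSite 2 L) :=
    Finset.univ.filter fun k : TorusSite 2 L => |twistedBand L θ μ k| ≤ 2 * π / L with hS
  have hScard : c' * L ≤ S.card := hcount L hL fun i => θ i / L
  -- modewise bounds
  have hfac : ∀ k : TorusSite 2 L, (1 - Real.exp (-(κ * L * twistedBand L θ μ k))) ^ 2 ≤
      (if k ∈ S then q else 1) * (1 + Real.exp (-(κ * L * twistedBand L θ μ k))) ^ 2 := by
    intro k
    have ht0 : 0 < Real.exp (-(κ * L * twistedBand L θ μ k)) := Real.exp_pos _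
    by_cases hk : k ∈ S
    · rw [if_pos hk]
      have hξ : |twistedBand L θ μ k| ≤ 2 * π / L := (Finset.mem_filter.mp hk).2
      rw [abs_le] at hξ
      have hβξ : |κ * L * twistedBand L θ μ k| ≤ 2 * π * κ := by
        rw [abs_le]
        have h1 : κ * L * (2 * π / L) = 2 * π * κ := by field_simp
        constructor <;> nlinarith [mul_pos hκ hLpos]
      rw [abs_le] at hβξ
      have hrt : r ≤ Real.exp (-(κ * L * twistedBand L θ μ k)) :=
        Real.exp_le_exp.mpr (by linarith)
      have htr : Real.exp (-(κ * L * twistedBand L θ μ k)) * r ≤ 1 := by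
        rw [hr, ← Real.exp_add, Real.exp_le_one_iff]
        linarith
      have h := one_sub_sq_mul_le hrt htr
      rw [hq, div_pow, div_mul_eq_mul_div, le_div_iff₀ (by positivity)]
      linarith
    · rw [if_neg hk, one_mul]
      nlinarith
  have hprod := Finset.prod_le_prod (s := Finset.univ) (fun k _ => sq_nonneg _) fun k _ => hfac k
  rw [Finset.prod_mul_distrib, Finset.prod_ite_mem, Finset.univ_inter, Finset.prod_const] at hprod
  -- `q^{#S} ≤ e^{-cL}`
  have hqS : q ^ S.card ≤ Real.exp (-(c' * -Real.log q * L)) := by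
    rw [← Real.exp_log (pow_pos hq0 S.card), Real.log_pow, Real.exp_le_exp]
    nlinarith
  have hZ : 0 ≤ ∏ k : TorusSite 2 L, (1 + Real.exp (-(κ * L * twistedBand L θ μ k))) ^ 2 :=
    Finset.prod_nonneg fun k _ => sq_nonneg _
  rw [abs_of_nonneg (Finset.prod_nonneg fun k _ => sq_nonneg _)]
  exact hprod.trans (mul_le_mul_of_nonneg_right hqS hZ)

end Summit.HubbardSuperconductivity.HubbardSuperconductivity.Theorems.SpinStructureRigidity
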